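import Summits.AtomisticToContinuum.BoseEinsteinCondensation.Theorems.BECGroundStateSOSPeriodicIRBoundReduction
import Summits.AtomisticToContinuum.BoseEinsteinCondensation.Theorems.BECGroundStateSOSPeriodicIRBoundZeroMomentumGapBounded
import HarnessLib

/-!
# Route `BECGroundStateSOS`, crux `PeriodicIRBound` (stmt-AtomisticToContinuum-3972),
# line `linear-ph-floor-wagner` — the crux for BOUNDED potentials reduces to stmt-9091 ∧ stmt-9094

Sequel of `…PeriodicIRBoundReduction.lean` (seat -1, p96154) after seat c1's stub 3a
`zeroMomentumGapFor_of_bounded` (`…PeriodicIRBoundZeroMomentumGapBounded.lean`, p96472: the fixed-`(N,L)`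
zero-momentum gap for every bounded admissible `v`, from the tree's `PeriodicGroundStateNondegenerate_holds`).
For a BOUNDED repulsive finite-range pair potential (`v ≤ M < ⊤`; then `∫ v(|x|)dx < ∞`,
`lintegral_norm_ne_top_of_bounded`) the crux's infrared bound needs no spectral input beyond the linear
particle–hole floor `C⁺(v)`: `irBoundFor_of_linearFloor_of_bounded`. Globally, the crux restricted to bounded
potentials follows from the two pooled sibling items stmt-9091 `LandauSectorBound` and stmt-9094
`EnergyConvexityWindow` alone (`stub_reductionBounded`, registered by-product sub-goal, conclusion in γ-form
`GroundIRBoundFor`; `boundedClass_of_pooled` in the crux's own `IRBoundFor` form), and the whole crux from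
stmt-9091, stmt-9094, the residual stub 3b (zero-momentum gap for UNBOUNDED integrable `v`) and stub 6b
(`periodicIRBound_of_open_inputs_v7`, matching seat c1's skeleton v7).
-/

noncomputable section

open scoped BigOperators ENNReal
open Filter MeasureTheory

namespace Summit.AtomisticToContinuum.BoseEinsteinCondensation.Cruxes.PeriodicIRBound.LinearPhFloorWagner

open Literature.MathematicalPhysics.QuantumManyBody.BoseGas
open Summit.AtomisticToContinuum.BoseEinsteinCondensation.Theses.BECGroundStateSOS (PeriodicIRBound)
open Summit.AtomisticToContinuum.BoseEinsteinCondensation.Theses.BECSectorPoincareTwoScale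
  (LandauSectorBound EnergyConvexityWindow)
open Summit.AtomisticToContinuum.BoseEinsteinCondensation.Theorems.PeriodicIRBound.Negative
  (IRBoundFor irBoundFor_iff_ground periodicIRBound_iff_split)

/-- A bounded finite-range profile is integrable on `ℝ³`: `∫ v(|x|) dx ≤ M · |B(0,R₀)| < ∞`. [folklore] -/
theorem lintegral_norm_ne_top_of_bounded {v : ℝ → ℝ≥0∞} (hv : IsRepulsiveFiniteRange v)
    (hM : ∃ M : ℝ≥0∞, M ≠ ⊤ ∧ ∀ r, v r ≤ M) : (∫⁻ x : Space, v ‖x‖) ≠ ⊤ := by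
  obtain ⟨M, hMtop, hle⟩ := hM
  obtain ⟨R₀, hR₀⟩ := hv.2
  have hbound : ∀ x : Space,
      v ‖x‖ ≤ (Metric.closedBall (0 : Space) R₀).indicator (fun _ => M) x := by
    intro x
    by_cases hx : x ∈ Metric.closedBall (0 : Space) R₀
    · rw [Set.indicator_of_mem hx]
      exact hle _
    · rw [Set.indicator_of_notMem hx]
      have hx' : R₀ < ‖x‖ := by
        rw [Metric.mem_closedBall, dist_zero_right, not_le] at hx
        exact hx
      rw [hR₀ _ hx']
  refine ne_top_of_le_ne_top ?_ (lintegral_mono hbound)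
  rw [lintegral_indicator measurableSet_closedBall, setLIntegral_const]
  exact ENNReal.mul_ne_top hMtop measure_closedBall_lt_top.ne

/-- **Bounded potentials, per `v`: the infrared bound from `C⁺(v)` alone.** For a bounded admissible `v`
the fixed-`(N,L)` zero-momentum gap is a theorem (`zeroMomentumGapFor_of_bounded`, seat c1), so the
two-sided Wagner–Feynman chain (`irBoundFor_of_linearFloor_of_gap`) needs only the linear particle–hole floor
(when `∫v ≠ 0`). [folklore] -/
theorem irBoundFor_of_linearFloor_of_bounded (v : ℝ → ℝ≥0∞) (hv : IsRepulsiveFiniteRange v)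
    (hM : ∃ M : ℝ≥0∞, M ≠ ⊤ ∧ ∀ r, v r ≤ M)
    (hfloor : (∫⁻ x : Space, v ‖x‖) ≠ 0 → LinearFloorFor v) : IRBoundFor v :=
  irBoundFor_of_linearFloor_of_gap v hv (lintegral_norm_ne_top_of_bounded hv hM) hfloor
    (zeroMomentumGapFor_of_bounded hv hM)

/-- **Registered by-product sub-goal `stub_reductionBounded`: the crux for every BOUNDED admissible
potential, in γ-form, from the pooled items stmt-9091 and stmt-9094 alone.** [folklore] -/
theorem stub_reductionBounded : LandauSectorBound → EnergyConvexityWindow →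
    ∀ v : ℝ → ℝ≥0∞, IsRepulsiveFiniteRange v → (∃ M : ℝ≥0∞, M ≠ ⊤ ∧ ∀ r, v r ≤ M) →
      GroundIRBoundFor v :=
  fun h₁ h₂ v hv hM =>
    (groundIRBoundFor_iff v).2
      (irBoundFor_of_linearFloor_of_bounded v hv hM (linearParticleHoleFloor_of_pooled h₁ h₂ v hv))

/-- The crux restricted to bounded admissible potentials (in its own `IRBoundFor` form) from stmt-9091 and
stmt-9094. [folklore] -/
theorem boundedClass_of_pooled (h₁ : LandauSectorBound) (h₂ : EnergyConvexityWindow) :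
    ∀ v : ℝ → ℝ≥0∞, IsRepulsiveFiniteRange v → (∃ M : ℝ≥0∞, M ≠ ⊤ ∧ ∀ r, v r ≤ M) →
      IRBoundFor v :=
  fun v hv hM => (groundIRBoundFor_iff v).1 (stub_reductionBounded h₁ h₂ v hv hM)

/-- **The crux BY NAME from its open inputs after skeleton v7**: stmt-9091, stmt-9094, the residual stub 3b
(zero-momentum gap for UNBOUNDED integrable admissible `v`, the unbounded half of stmt-11845) and stub 6b
(`HardCoreWagnerFeynmanBound`). [folklore] -/
theorem periodicIRBound_of_open_inputs_v7 (h₁ : LandauSectorBound) (h₂ : EnergyConvexityWindow)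
    (h₃ : ∀ v : ℝ → ℝ≥0∞, IsRepulsiveFiniteRange v → (∫⁻ x : Space, v ‖x‖) ≠ ⊤ →
      (¬ ∃ M : ℝ≥0∞, M ≠ ⊤ ∧ ∀ r, v r ≤ M) → ZeroMomentumGapFor v)
    (h₈ : HardCoreWagnerFeynmanBound) : PeriodicIRBound := by
  refine periodicIRBound_iff_split.2 ⟨fun v hv hint => ?_, nonIntegrableHalf_of_pooled h₁ h₂ h₈⟩
  by_cases hbdd : ∃ M : ℝ≥0∞, M ≠ ⊤ ∧ ∀ r, v r ≤ M
  · exact boundedClass_of_pooled h₁ h₂ v hv hbdd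
  · exact irBoundFor_of_linearFloor_of_gap v hv hint (linearParticleHoleFloor_of_pooled h₁ h₂ v hv)
      (h₃ v hv hint hbdd)

end Summit.AtomisticToContinuum.BoseEinsteinCondensation.Cruxes.PeriodicIRBound.LinearPhFloorWagner

end
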